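import Literature.NumberTheory.EllipticCurves.BhargavaShankarCountingProofs
import Literature.NumberTheory.EllipticCurves.SelmerTwoTorsionBoundProofs
import Literature.NumberTheory.EllipticCurves.QuadraticTwistProofs
import Literature.NumberTheory.Sieve.DivisorBound
import Mathlib.NumberTheory.Padics.HeightOneSpectrum
import HarnessLib

/-!
# Bhargava–Shankar, Prop. 5.8, proved: the `2`-Selmer groups of the curves with a rational
# `2`-torsion point are negligible (discharge of `bhargavaShankar_sum_card_selmerTwo_twoTorsion_le`)

`Proofs` companion of `BhargavaShankarCounting.lean`. It discharges the named fact
`Literature.NumberTheory.EllipticCurves.bhargavaShankar_sum_card_selmerTwo_twoTorsion_le` —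
M. Bhargava, A. Shankar, *Binary quartic forms having bounded invariants, and the boundedness of
the average rank of elliptic curves*, Ann. of Math. (2) 181 (2015) 191–242, **Prop. 5.8** of the
held arXiv text `arXiv:1006.1002v2` (§5.1, p. 32): *"The total number of elements in the union of
the `2`-Selmer groups of all elliptic curves over `ℚ` having a nontrivial rational `2`-torsion
point and height bounded by `X` is `O(X^{3/4+ε})`"* — one of the three printed inputs left open by
the tree's assembly of Theorem 1.1 (`average_card_selmerTwo_of_BS_facts`,
`BhargavaShankarCountingProofs`).

The printed proof ("follows from Lemma 3.21 and Theorem 5.6": the parametrization of Selmer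
elements by binary quartic forms and the count of quartic forms with reducible cubic resolvent)
is replaced by the classical **`2`-descent bound**, which gives the stronger `O(X^{1/2+ε})`:

1. `natCard_selmerTwo_le_of_hasRationalTwoTorsion`: for `(A, B)` in the height family with
   `x³ + Ax + B` having a rational root, `#Sel^{(2)}(E_{A,B}/ℚ) ≤ 4 · 4^{ω(2(4A³+27B²))}`. This is
   `WeierstrassCurve.natCard_selmerGroup_two_le_four_pow` (`SelmerTwoTorsionBoundProofs`:
   `#Sel^{(2)} ≤ 4^{#S+1}`, Silverman AEC X.4.9 / Cor. X.4.4 in cohomological form) for the set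
   `S` of places dividing `2(4A³ + 27B²)`, which contains `2` and the bad places of the integral
   model `y² = x³ + Ax + B` (`Δ = −16(4A³+27B²)`; AEC VII.5.1(a) / VIII.1 Rem. 1.3 via the tree's
   `hasGoodReductionAt_of_valuation_le_one_of_valuation_Δ_eq_one`), and the rational `2`-torsion
   point `(r, 0)`.
2. `4^{ω(D)} ≤ d(D)² ≤ C_δ² D^{2δ}` (the divisor bound, tree file `Sieve/DivisorBound`,
   Hardy–Wright Thm 315), with `D = |2(4A³+27B²)| ≤ 4X` for curves of height `< X`.
3. Prop. 5.7 (proved in the tree, `card_filter_hasRationalTwoTorsion_le`: at most `15 X^{1/2}`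
   such curves). Hence the sum is `≤ 15 X^{1/2} · 4 C² 4^ε X^ε ≤ C' X^{3/4+ε}`.

With this file, Theorem 1.1 (`average_card_selmerTwo`) and Cor. 1.2 depend on exactly two named
facts: Thm 5.6 (`bhargavaShankar_card_selmerTwo_eq`) and eq. (31) with Prop. 5.12
(`bhargavaShankar_sum_irredClassCount_asymptotic`): `average_card_selmerTwo_of_two_BS_facts`,
`heightAverageLE_card_selmerTwo_of_two_BS_facts`.

## References

* M. Bhargava, A. Shankar, Ann. of Math. (2) 181 (2015) 191–242 = arXiv:1006.1002, §5.1,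
  Props. 5.7–5.8 (arXiv v2 numbering). [cite: BhargavaShankarAnnals2015, Prop. 5.8 (arXiv:1006.1002v2 numbering)]
* J. H. Silverman, *The Arithmetic of Elliptic Curves*, 2nd ed. (2009), VII.5.1, VIII.1
  Remark 1.3, X.4.9, Cor. X.4.4. [cite: SilvermanAEC2009, Prop. X.4.9]
* G. H. Hardy, E. M. Wright, *An Introduction to the Theory of Numbers*, Thm 315 (divisor bound).

## Tree / Mathlib reuse

Tree: `natCard_selmerGroup_two_le_four_pow` (`SelmerTwoTorsionBoundProofs`);
`hasGoodReductionAt_of_valuation_le_one_of_valuation_Δ_eq_one`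
(`LocalReductionFiniteBadPlacesProofs`); `card_filter_hasRationalTwoTorsion_le`,
`isElliptic_shortWeierstrass`, `mem_heightFamilyBelow_iff`, `naiveHeight_nonneg`
(`BhargavaShankarCountingProofs`, `HeightFamily`); `valuation_ringOfIntegers_intCast_le_one`,
`valuation_ringOfIntegers_intCast_eq_one` (`QuadraticTwistProofs`);
`exists_card_divisors_le_mul_rpow'` (`Sieve/DivisorBound`). Mathlib:
`Rat.HeightOneSpectrum.primesEquiv`, `natGenerator_dvd_iff`, `Nat.card_divisors`,
`Finset.pow_card_le_prod`, `Finset.sum_le_card_nsmul`.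

## Design

No definitions; the set of places `S = {v : p_v ∣ D}` is written inline. `noncomputable section`,
`open scoped Classical` as in the files served.
-/

noncomputable section

open scoped Classical NumberField

open Filter NumberField IsDedekindDomain Field Rat.HeightOneSpectrum Finset

namespace Literature.NumberTheory.EllipticCurves

/-! ## Places of `ℚ` and rational primes -/

/-- If the rational prime `m` lies in the finite place `v` of `ℚ`, then the prime `p_v` under `v`
(`Rat.HeightOneSpectrum.primesEquiv v`) divides `m`. [folklore] -/
theorem Rat.primesEquiv_dvd_of_natCast_mem_asIdeal (v : HeightOneSpectrum (𝓞 ℚ)) {m : ℕ}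
    (hv : (m : 𝓞 ℚ) ∈ v.asIdeal) : (primesEquiv v : ℕ) ∣ m := by
  change natGenerator v ∣ m
  rw [natGenerator_dvd_iff, Ideal.mem_map_of_equiv]
  exact ⟨m, hv, map_natCast _ m⟩

/-- The places of `ℚ` whose prime divides `D ≠ 0` form a finite set with at most `ω(D)` elements
(`v ↦ p_v` is injective, `primesEquiv`). [folklore] -/
theorem Rat.finite_setOf_primesEquiv_dvd {D : ℕ} (hD : D ≠ 0) :
    {v : HeightOneSpectrum (𝓞 ℚ) | (primesEquiv v : ℕ) ∣ D}.Finite ∧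
      Nat.card {v : HeightOneSpectrum (𝓞 ℚ) | (primesEquiv v : ℕ) ∣ D} ≤ D.primeFactors.card := by
  let f : {v : HeightOneSpectrum (𝓞 ℚ) | (primesEquiv v : ℕ) ∣ D} → D.primeFactors := fun v ↦
    ⟨primesEquiv v.1, Nat.mem_primeFactors.mpr ⟨(primesEquiv v.1).2, v.2, hD⟩⟩
  have hf : Function.Injective f := by
    intro v w h
    have h' : (primesEquiv v.1 : ℕ) = primesEquiv w.1 := congrArg (fun x : D.primeFactors ↦ (x : ℕ)) h
    exact Subtype.ext (primesEquiv.injective (Subtype.ext h'))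
  have hfin : Finite {v : HeightOneSpectrum (𝓞 ℚ) | (primesEquiv v : ℕ) ∣ D} :=
    Finite.of_injective f hf
  refine ⟨Set.finite_coe_iff.mp hfin, ?_⟩
  calc Nat.card {v : HeightOneSpectrum (𝓞 ℚ) | (primesEquiv v : ℕ) ∣ D}
      ≤ Nat.card D.primeFactors := Nat.card_le_card_of_injective f hf
    _ = D.primeFactors.card := by rw [Nat.card_eq_fintype_card, Fintype.card_coe]

/-! ## The curves `E_{A,B}`: bad places and the rational `2`-torsion point -/

/-- `Δ(E_{A,B}) = −16(4A³ + 27B²)` (Silverman, *AEC*, III.§1). [folklore] -/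
theorem Δ_shortWeierstrass (AB : ℤ × ℤ) :
    (shortWeierstrass AB).Δ = ((-16 * (4 * AB.1 ^ 3 + 27 * AB.2 ^ 2) : ℤ) : ℚ) := by
  simp only [shortWeierstrass, WeierstrassCurve.Δ, WeierstrassCurve.b₂, WeierstrassCurve.b₄,
    WeierstrassCurve.b₆, WeierstrassCurve.b₈]
  push_cast
  ring

/-- **The bad places of `y² = x³ + Ax + B` divide `2(4A³ + 27B²)`**: at a place `v` with
`p_v ∤ 2(4A³+27B²)` the integral equation has unit discriminant `Δ = −16(4A³+27B²)`, hence good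
reduction (Silverman, *AEC*, VII.5.1(a) with VIII.1 Remark 1.3; tree
`hasGoodReductionAt_of_valuation_le_one_of_valuation_Δ_eq_one`). [cite: SilvermanAEC2009, VIII.1 Remark 1.3] -/
theorem badPlaces_shortWeierstrass_subset (AB : ℤ × ℤ) :
    (shortWeierstrass AB).badPlaces (𝓞 ℚ) ⊆
      {v | (primesEquiv v : ℕ) ∣ (2 * (4 * AB.1 ^ 3 + 27 * AB.2 ^ 2)).natAbs} := by
  intro v hv
  by_contra hnd
  apply ((shortWeierstrass AB).mem_badPlaces_iff v).mp hv
  have hp : (primesEquiv v : ℕ).Prime := (primesEquiv v).2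
  have hpZ : Prime ((primesEquiv v : ℕ) : ℤ) := Nat.prime_iff_prime_int.mp hp
  have hndvd : ¬ ((primesEquiv v : ℕ) : ℤ) ∣ -16 * (4 * AB.1 ^ 3 + 27 * AB.2 ^ 2) := by
    intro hd
    apply hnd
    change (primesEquiv v : ℕ) ∣ (2 * (4 * AB.1 ^ 3 + 27 * AB.2 ^ 2)).natAbs
    rw [← Int.natCast_dvd]
    rw [show (-16 : ℤ) * (4 * AB.1 ^ 3 + 27 * AB.2 ^ 2) = -(2 ^ 4 * (4 * AB.1 ^ 3 + 27 * AB.2 ^ 2))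
      by ring, dvd_neg] at hd
    rcases hpZ.dvd_or_dvd hd with h16 | hm
    · exact (hpZ.dvd_of_dvd_pow h16).trans (dvd_mul_right _ _)
    · exact hm.trans (dvd_mul_left _ _)
  have hval : v.valuation ℚ (shortWeierstrass AB).Δ = 1 := by
    rw [Δ_shortWeierstrass]
    exact WeierstrassCurve.valuation_ringOfIntegers_intCast_eq_one v hndvd
  refine (shortWeierstrass AB).hasGoodReductionAt_of_valuation_le_one_of_valuation_Δ_eq_one v
    ?_ ?_ ?_ ?_ ?_ hval
  · simp [shortWeierstrass]
  · simp [shortWeierstrass]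
  · simp [shortWeierstrass]
  · simpa [shortWeierstrass] using WeierstrassCurve.valuation_ringOfIntegers_intCast_le_one v AB.1
  · simpa [shortWeierstrass] using WeierstrassCurve.valuation_ringOfIntegers_intCast_le_one v AB.2

/-- The place above `2` divides `2(4A³ + 27B²)`. [folklore] -/
theorem mem_setOf_primesEquiv_dvd_of_two_mem (AB : ℤ × ℤ) (v : HeightOneSpectrum (𝓞 ℚ))
    (hv : ((2 : ℤ) : 𝓞 ℚ) ∈ v.asIdeal) :
    v ∈ {v : HeightOneSpectrum (𝓞 ℚ) |
      (primesEquiv v : ℕ) ∣ (2 * (4 * AB.1 ^ 3 + 27 * AB.2 ^ 2)).natAbs} := by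
  have hv' : ((2 : ℕ) : 𝓞 ℚ) ∈ v.asIdeal := by exact_mod_cast hv
  have h2 := Rat.primesEquiv_dvd_of_natCast_mem_asIdeal v hv'
  change (primesEquiv v : ℕ) ∣ (2 * (4 * AB.1 ^ 3 + 27 * AB.2 ^ 2)).natAbs
  rw [Int.natAbs_mul, show (2 : ℤ).natAbs = 2 from rfl]
  exact h2.trans (dvd_mul_right _ _)

/-- **The rational `2`-torsion point, geometrically.** If `x³ + Ax + B` has a rational root `r`
(`HasRationalTwoTorsion`), then `P = (r, 0) ∈ E_{A,B}(ℚ̄)` is a nonzero point with `2P = O` fixed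
by `G_ℚ`. Bhargava–Shankar, held arXiv text p. 32 ("`E` has a non-trivial rational `2`-torsion
point iff `x³+Ax+B` has a rational root"); Silverman, *AEC*, III.2.3(d). [cite: BhargavaShankarAnnals2015, §5.1 p. 32 (arXiv:1006.1002v2 numbering)] -/
theorem exists_geomTorsion_two_of_hasRationalTwoTorsion {AB : ℤ × ℤ} (hAB : IsInHeightFamily AB)
    (h : HasRationalTwoTorsion AB) :
    ∃ P : (shortWeierstrass AB).geomPoints, P ≠ 0 ∧ P ∈ (shortWeierstrass AB).geomTorsion 2 ∧
      ∀ σ : absoluteGaloisGroup ℚ, σ • P = P := by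
  obtain ⟨r, hr⟩ := h
  haveI := isElliptic_shortWeierstrass hAB
  set x : AlgebraicClosure ℚ := algebraMap ℚ (AlgebraicClosure ℚ) r with hx
  have heq : ((shortWeierstrass AB).baseChange (AlgebraicClosure ℚ)).toAffine.Equation x 0 := by
    rw [WeierstrassCurve.Affine.equation_iff]
    have hr' := congrArg (algebraMap ℚ (AlgebraicClosure ℚ)) hr
    rw [map_add, map_add, map_pow, map_mul, map_zero, map_intCast, map_intCast] at hr'
    simp only [shortWeierstrass, WeierstrassCurve.baseChange, WeierstrassCurve.map_a₁,
      WeierstrassCurve.map_a₂, WeierstrassCurve.map_a₃, WeierstrassCurve.map_a₄,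
      WeierstrassCurve.map_a₆, map_zero, map_intCast]
    rw [← hx] at hr'
    linear_combination -hr'
  have hns : ((shortWeierstrass AB).baseChange (AlgebraicClosure ℚ)).toAffine.Nonsingular x 0 :=
    (WeierstrassCurve.Affine.equation_iff_nonsingular).mp heq
  refine ⟨WeierstrassCurve.Affine.Point.some x 0 hns, WeierstrassCurve.Affine.Point.some_ne_zero hns,
    ?_, fun σ ↦ ?_⟩
  · refine (Submodule.mem_torsionBy_iff (2 : ℤ) _).mpr ?_
    rw [two_zsmul]
    refine WeierstrassCurve.Affine.Point.add_self_of_Y_eq ?_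
    simp [WeierstrassCurve.Affine.negY, shortWeierstrass]
  · change WeierstrassCurve.Affine.Point.map
      ((show AlgebraicClosure ℚ ≃ₐ[ℚ] AlgebraicClosure ℚ from σ) :
        AlgebraicClosure ℚ →ₐ[ℚ] AlgebraicClosure ℚ) (WeierstrassCurve.Affine.Point.some x 0 hns) =
      WeierstrassCurve.Affine.Point.some x 0 hns
    simp only [WeierstrassCurve.Affine.Point.map_some, hx, AlgHom.commutes, map_zero]

/-! ## The `2`-descent bound for `E_{A,B}` -/

/-- **`#Sel^{(2)}(E_{A,B}/ℚ) ≤ 4 · 4^{ω(2(4A³+27B²))}`** for `(A, B)` in the height family with a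
rational `2`-torsion point: `WeierstrassCurve.natCard_selmerGroup_two_le_four_pow`
(`#Sel^{(2)} ≤ 4^{#S+1}`, Silverman AEC X.4.9 / Cor. X.4.4) for `S = {v : p_v ∣ 2(4A³+27B²)}`,
which contains `2` and the bad places and has at most `ω(2(4A³+27B²))` elements.
[cite: SilvermanAEC2009, Prop. X.4.9] -/
theorem natCard_selmerTwo_le_of_hasRationalTwoTorsion {AB : ℤ × ℤ} (hAB : IsInHeightFamily AB)
    (h : HasRationalTwoTorsion AB) :
    (Nat.card ((shortWeierstrass AB).selmerGroup 2) : ℝ) ≤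
      4 * 4 ^ ((2 * (4 * AB.1 ^ 3 + 27 * AB.2 ^ 2)).natAbs).primeFactors.card := by
  haveI := isElliptic_shortWeierstrass hAB
  set D : ℕ := (2 * (4 * AB.1 ^ 3 + 27 * AB.2 ^ 2)).natAbs with hDdef
  have hD : D ≠ 0 := by
    rw [hDdef, Ne, Int.natAbs_eq_zero]
    exact mul_ne_zero two_ne_zero hAB.1
  obtain ⟨hSfin, hScard⟩ := Rat.finite_setOf_primesEquiv_dvd hD
  obtain ⟨P, hP0, hP2, hPfix⟩ := exists_geomTorsion_two_of_hasRationalTwoTorsion hAB h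
  have hle := (shortWeierstrass AB).natCard_selmerGroup_two_le_four_pow P hP0 hP2 hPfix hSfin
    (badPlaces_shortWeierstrass_subset AB) (mem_setOf_primesEquiv_dvd_of_two_mem AB)
  calc (Nat.card ((shortWeierstrass AB).selmerGroup 2) : ℝ)
      ≤ (4 : ℝ) ^ (Nat.card {v : HeightOneSpectrum (𝓞 ℚ) | (primesEquiv v : ℕ) ∣ D} + 1) := by
        exact_mod_cast hle
    _ ≤ 4 ^ (D.primeFactors.card + 1) := pow_le_pow_right₀ (by norm_num) (by omega)
    _ = 4 * 4 ^ D.primeFactors.card := by rw [pow_succ, mul_comm]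

/-! ## Prop. 5.8 -/

/-- **Bhargava–Shankar, Prop. 5.8, proved** (held arXiv text §5.1, p. 32): discharge of the named
fact `bhargavaShankar_sum_card_selmerTwo_twoTorsion_le` — the `2`-Selmer groups of the curves
`E_{A,B}` of height `< X` with a rational `2`-torsion point have `O(X^{3/4+ε})` elements in total.
Proof (by `2`-descent rather than the printed route through Thm 5.6 and Lemma 3.21, giving in
fact `O(X^{1/2+ε})`): each such curve has `#Sel^{(2)} ≤ 4·4^{ω(D)} ≤ 4 d(D)² ≤ 4C²(4X)^{ε}`,
`D = |2(4A³+27B²)| ≤ 4X` (`natCard_selmerTwo_le_of_hasRationalTwoTorsion`, `4^{ω(D)} ≤ d(D)²` and the divisor bound), and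
there are at most `15 X^{1/2}` of them (Prop. 5.7, `card_filter_hasRationalTwoTorsion_le`).
[cite: BhargavaShankarAnnals2015, Prop. 5.8 (arXiv:1006.1002v2 numbering)] -/
theorem bhargavaShankar_sum_card_selmerTwo_twoTorsion_le_holds :
    bhargavaShankar_sum_card_selmerTwo_twoTorsion_le := by
  intro ε hε
  obtain ⟨C, hC1, hC⟩ := Literature.NumberTheory.Sieve.exists_card_divisors_le_mul_rpow' (half_pos hε)
  have hC0 : 0 ≤ C := zero_le_one.trans hC1
  set B : ℝ := 4 * (C * (4 : ℝ) ^ (ε / 2)) ^ 2 with hB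
  have hB0 : 0 ≤ B := by positivity
  refine ⟨15 * B, fun X ↦ ?_⟩
  rcases Nat.eq_zero_or_pos X with rfl | hX
  · have hempty : (heightFamilyBelow 0).filter HasRationalTwoTorsion = ∅ := by
      ext AB
      simp only [Finset.mem_filter, mem_heightFamilyBelow_iff, Nat.cast_zero,
        Finset.notMem_empty, iff_false, not_and]
      intro h
      exact absurd h.2 (not_lt.mpr (naiveHeight_nonneg AB))
    rw [hempty, Finset.sum_empty]
    exact mul_nonneg (mul_nonneg (by norm_num) hB0) (Real.rpow_nonneg (Nat.cast_nonneg _) _)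
  have hX1 : (1 : ℝ) ≤ X := by exact_mod_cast hX
  have hX0 : (0 : ℝ) < X := by positivity
  -- `4^{ω(n)} ≤ d(n)²` for `n ≠ 0`: each prime factor contributes a factor `≥ 2` to
  -- `d(n) = ∏ (v_p(n) + 1)`
  have hfour : ∀ {n : ℕ}, n ≠ 0 → (4 : ℝ) ^ n.primeFactors.card ≤ (n.divisors.card : ℝ) ^ 2 := by
    intro n hn
    have h2 : 2 ^ n.primeFactors.card ≤ n.divisors.card := by
      rw [Nat.card_divisors hn]
      refine Finset.pow_card_le_prod _ _ _ fun p hp ↦ ?_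
      have := Nat.mem_primeFactors.mp hp
      have hpos : 0 < n.factorization p := this.1.factorization_pos_of_dvd hn this.2.1
      omega
    have h2' : (2 : ℝ) ^ n.primeFactors.card ≤ (n.divisors.card : ℝ) := by exact_mod_cast h2
    calc (4 : ℝ) ^ n.primeFactors.card = ((2 : ℝ) ^ n.primeFactors.card) ^ 2 := by
          rw [← pow_mul, mul_comm, pow_mul]; norm_num
      _ ≤ (n.divisors.card : ℝ) ^ 2 := by gcongr
  -- the bound for one curve
  have hterm : ∀ AB ∈ (heightFamilyBelow X).filter HasRationalTwoTorsion,
      (Nat.card ((shortWeierstrass AB).selmerGroup 2) : ℝ) ≤ B * (X : ℝ) ^ ε := by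
    intro AB hmem
    rw [Finset.mem_filter, mem_heightFamilyBelow_iff] at hmem
    obtain ⟨⟨hfam, hH⟩, htor⟩ := hmem
    set D : ℕ := (2 * (4 * AB.1 ^ 3 + 27 * AB.2 ^ 2)).natAbs with hDdef
    have hD : D ≠ 0 := by
      rw [hDdef, Ne, Int.natAbs_eq_zero]
      exact mul_ne_zero two_ne_zero hfam.1
    -- `D ≤ 4X`
    have hDX : (D : ℝ) ≤ 4 * X := by
      have hA : 4 * |AB.1| ^ 3 < (X : ℤ) := lt_of_le_of_lt (le_max_left _ _) hH
      have hB' : 27 * AB.2 ^ 2 < (X : ℤ) := lt_of_le_of_lt (le_max_right _ _) hH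
      have hDZ : (D : ℤ) ≤ 4 * X := by
        rw [hDdef, Int.natCast_natAbs, abs_mul]
        have h1 : |4 * AB.1 ^ 3 + 27 * AB.2 ^ 2| ≤ 4 * |AB.1| ^ 3 + 27 * AB.2 ^ 2 := by
          calc |4 * AB.1 ^ 3 + 27 * AB.2 ^ 2| ≤ |4 * AB.1 ^ 3| + |27 * AB.2 ^ 2| := abs_add_le _ _
            _ = 4 * |AB.1| ^ 3 + 27 * AB.2 ^ 2 := by
                rw [abs_mul, abs_mul, abs_pow, abs_of_nonneg (sq_nonneg AB.2)]; norm_num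
        have h2 : |(2 : ℤ)| = 2 := by norm_num
        rw [h2]
        linarith
      exact_mod_cast hDZ
    calc (Nat.card ((shortWeierstrass AB).selmerGroup 2) : ℝ)
        ≤ 4 * 4 ^ D.primeFactors.card := natCard_selmerTwo_le_of_hasRationalTwoTorsion hfam htor
      _ ≤ 4 * (D.divisors.card : ℝ) ^ 2 := by
          gcongr
          exact hfour hD
      _ ≤ 4 * (C * (D : ℝ) ^ (ε / 2)) ^ 2 := by
          gcongr
          exact hC D
      _ ≤ 4 * (C * (4 * X : ℝ) ^ (ε / 2)) ^ 2 := by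
          gcongr
      _ = B * (X : ℝ) ^ ε := by
          rw [hB, Real.mul_rpow (by norm_num) hX0.le]
          have hXpow : ((X : ℝ) ^ (ε / 2)) ^ 2 = (X : ℝ) ^ ε := by
            rw [← Real.rpow_natCast, ← Real.rpow_mul hX0.le]
            norm_num
          rw [← hXpow]
          ring
  -- sum ≤ (number of curves) · (bound for one curve)
  have hsum := Finset.sum_le_card_nsmul _ _ _ hterm
  rw [nsmul_eq_mul] at hsum
  have hcard := card_filter_hasRationalTwoTorsion_le X
  calc (∑ AB ∈ (heightFamilyBelow X).filter HasRationalTwoTorsion,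
        (Nat.card ((shortWeierstrass AB).selmerGroup 2) : ℝ))
      ≤ (((heightFamilyBelow X).filter HasRationalTwoTorsion).card : ℝ) * (B * (X : ℝ) ^ ε) := hsum
    _ ≤ 15 * (X : ℝ) ^ (1 / 2 : ℝ) * (B * (X : ℝ) ^ ε) := by gcongr
    _ = 15 * B * ((X : ℝ) ^ (1 / 2 + ε)) := by
        rw [Real.rpow_add hX0]; ring
    _ ≤ 15 * B * (X : ℝ) ^ (3 / 4 + ε) :=
        mul_le_mul_of_nonneg_left (Real.rpow_le_rpow_of_exponent_le hX1 (by norm_num))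
          (by positivity)

/-! ## Theorem 1.1 and Cor. 1.2 granted the two remaining printed inputs -/

/-- **Bhargava–Shankar, Theorem 1.1, granted Thm 5.6 and eq. (31) (with Prop. 5.12, Lemma 5.16)
of the held arXiv text** — Lemma 5.15, Prop. 5.7 and now Prop. 5.8 being proved: the average size
of the `2`-Selmer group over the curves of naive height `< X` tends to `3`
(`Literature.NumberTheory.EllipticCurves.average_card_selmerTwo`).
[cite: BhargavaShankarAnnals2015, Thm 1.1 (arXiv:1006.1002v2 numbering)] -/
theorem average_card_selmerTwo_of_two_BS_facts (h56 : bhargavaShankar_card_selmerTwo_eq)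
    (h31 : bhargavaShankar_sum_irredClassCount_asymptotic) : EllipticCurves.average_card_selmerTwo :=
  EllipticCurves.average_card_selmerTwo_of_BS_facts h56 h31
    bhargavaShankar_sum_card_selmerTwo_twoTorsion_le_holds

/-- **Bhargava–Shankar, Theorem 1.1 in `limsup` form, granted Thm 5.6 and eq. (31)**
(`Literature.NumberTheory.EllipticCurves.heightAverageLE_card_selmerTwo`).
[cite: BhargavaShankarAnnals2015, Thm 1.1] -/
theorem heightAverageLE_card_selmerTwo_of_two_BS_facts (h56 : bhargavaShankar_card_selmerTwo_eq)
    (h31 : bhargavaShankar_sum_irredClassCount_asymptotic) :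
    EllipticCurves.heightAverageLE_card_selmerTwo :=
  EllipticCurves.heightAverageLE_card_selmerTwo_of_BS_facts h56 h31
    bhargavaShankar_sum_card_selmerTwo_twoTorsion_le_holds

/-- **Bhargava–Shankar, Cor. 1.2 (average rank `≤ 3/2`), granted Thm 5.6 and eq. (31)**
(`Literature.NumberTheory.EllipticCurves.averageRankLE_three_halves`).
[cite: BhargavaShankarAnnals2015, Cor. 1.2] -/
theorem averageRankLE_three_halves_of_two_BS_facts (h56 : bhargavaShankar_card_selmerTwo_eq)
    (h31 : bhargavaShankar_sum_irredClassCount_asymptotic) :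
    EllipticCurves.averageRankLE_three_halves :=
  EllipticCurves.averageRankLE_three_halves_of_BS_facts h56 h31
    bhargavaShankar_sum_card_selmerTwo_twoTorsion_le_holds

end Literature.NumberTheory.EllipticCurves

end
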